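import Mathlib
import HarnessLib
import Literature.AlgebraicGeometry.Ramification.InertiaNormalSylow
import Summits.ResolutionOfSingularities.ResolutionOfSingularities.Theorems.WildQuotientsWildQuotientResolutionPointMoveNpcClosedPoints
import Summits.ResolutionOfSingularities.ResolutionOfSingularities.Theorems.MarkedTransferCampaignW46MohWindowSurfaceGrowth

/-!
# Over the centre of a point move on a regular threefold the non-p-closed locus is FINITE (crux `WildQuotients.WildQuotientResolution`)

Crux stmt-ResolutionOfSingularities-15640 (`WildQuotientResolution`), registered stub
`stub_phaseZeroHighDim`, move-game track (`…PointMove` p810587). Item (R2) of this hand's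
addendum `PHASE0-DIM3-TERMINATION-v2.md` («Phase III of the terminating design is finite»):
the non-p-closed locus of an equivariant point move `π : X♯ → X′` over the centre `Z`,
`NPC(X♯) ∩ π⁻¹ Z`, is (i) CLOSED — the inert loci `{x | h ∈ I_x}` are closed over any SEPARATED
invariant base (`isClosed_inertiaLocus_of_isSeparated`, the equaliser argument of
✓`InertiaLocus.stub_isClosed_inertiaLocus` with «affine» weakened to «separated», applied to
`X♯ → X′ → X₁`), hence `NPC` is closed (`isClosed_npc'`, the argument of ✓`StubNpcCentre.isClosed_npc`: NPC is the finite union over the non-p-closed `H ≤ G` of `⋂_{h ∈ H} {x | h ∈ I_x}`); (ii) made of CLOSED POINTS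
(✓`PointMoveNoNpcCurves.isClosed_and_surjective_of_not_hasNormalSylow_inertia`); and (iii) a closed
subset of a Noetherian sober space all of whose points are closed is finite
(tree ✓`CampaignW46.SurfaceGrowth.finite_of_isClosed_of_forall_isClosed_singleton`: each irreducible
component is the closure of its generic point, a closed point). So a point move creates only FINITELY MANY non-p-closed points,
all closed and `κ(z)`-rational.

* `isClosed_inertiaLocus_of_isSeparated` — inert loci are closed over a separated invariant base.
* `isClosed_npc'` — the non-p-closed locus is closed when the inert loci are.
* `finite_npc_over_centre` — the theorem.

[OURS · crux stmt-ResolutionOfSingularities-15640 · helper toward `stub_phaseZeroHighDim`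
(threefold Phase 0, finiteness of Phase III); folklore, counted 0; AI-level work, weaker than
expert review.]
-/

-- single-problem summit: the doubled namespace component `ResolutionOfSingularities` is forced
set_option linter.dupNamespace false

namespace Summit.ResolutionOfSingularities.ResolutionOfSingularities.Theorems.WildQuotientResolution.PointMoveNoNpcCurves

open CategoryTheory CategoryTheory.Limits AlgebraicGeometry TopologicalSpace IsLocalRing
open Literature.AlgebraicGeometry.Resolution Literature.AlgebraicGeometry.Ramification

/-- **The inert locus `{x | h ∈ I_x}` is closed over a separated invariant base** (the proof of
✓`InertiaLocus.stub_isClosed_inertiaLocus` verbatim, with `IsAffineHom q` weakened to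
`IsSeparated q`: the locus is the range of the equaliser of `ρ h` and `𝟙` over `X₁`, a closed
immersion). [folklore; cf. AbbesSaito2011, 2.4; Stacks 01KM] -/
theorem isClosed_inertiaLocus_of_isSeparated {X' X₁ : Scheme.{0}} (q : X' ⟶ X₁) [IsSeparated q]
    {G : Type} [Group G] (ρ : G →* Aut X') (hρ : ∀ g : G, (ρ g).hom ≫ q = q) (h : G) :
    IsClosed {x : X' | h ∈ inertiaSubgroup ρ x} := by
  let Y' : Over X₁ := Over.mk q
  let f' : Y' ⟶ Y' := Over.homMk (ρ h).hom (hρ h)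
  let g' : Y' ⟶ Y' := 𝟙 Y'
  have : IsSeparated Y'.hom := inferInstanceAs (IsSeparated q)
  let e : (equalizer f' g').left ⟶ X' := (equalizer.ι f' g').left
  haveI : IsClosedImmersion e := isClosedImmersion_equalizer_ι_left f' g'
  have hcond : e ≫ (ρ h).hom = e := by
    have hc := congr($(equalizer.condition f' g').left)
    rw [Over.comp_left, Over.comp_left] at hc
    exact hc.trans (Category.comp_id _)
  suffices H : {x : X' | h ∈ inertiaSubgroup ρ x} = Set.range e.base by
    rw [H]
    exact e.isClosedEmbedding.isClosed_range
  ext x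
  rw [Set.mem_setOf_eq, mem_inertiaSubgroup_iff, Set.mem_range]
  constructor
  · intro hx
    let P : Over X₁ := Over.mk (X'.fromSpecResidueField x ≫ q)
    let i' : P ⟶ Y' := Over.homMk (X'.fromSpecResidueField x) rfl
    have hi : i' ≫ f' = i' ≫ g' := by
      ext1
      rw [Over.comp_left, Over.comp_left]
      exact hx.trans (Category.comp_id _).symm
    have h1 : (equalizer.lift i' hi).left ≫ e = X'.fromSpecResidueField x :=
      congr($(equalizer.lift_ι i' hi).left)
    refine ⟨(equalizer.lift i' hi).left.base (IsLocalRing.closedPoint (X'.residueField x)), ?_⟩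
    rw [← Scheme.Hom.comp_apply, h1]
    exact Scheme.fromSpecResidueField_apply x _
  · rintro ⟨z, rfl⟩
    haveI := epi_SpecMap_residueField (Y := X') (e.base z) (e.residueFieldMap z)
    rw [← cancel_epi (Spec.map (e.residueFieldMap z)),
      Scheme.Hom.SpecMap_residueFieldMap_fromSpecResidueField_assoc,
      Scheme.Hom.SpecMap_residueFieldMap_fromSpecResidueField, hcond]

/-- **The non-p-closed locus is closed when all inert loci are** (the argument of
✓`StubNpcCentre.isClosed_npc`, restated here to keep this file's imports light): it is the union,
over the finitely many subgroups `H ≤ G` without a normal Sylow `p`-subgroup, of the closed sets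
`⋂_{h ∈ H} {x | h ∈ I_x}` (subgroups of p-closed groups are p-closed). [folklore] -/
theorem isClosed_npc' {X : Scheme.{0}} {G : Type} [Group G] [Finite G] (ρ : G →* Aut X)
    (p : ℕ) [Fact p.Prime] (hcl : ∀ h : G, IsClosed {x : X | h ∈ inertiaSubgroup ρ x}) :
    IsClosed {x : X | ¬ HasNormalSylow p (inertiaSubgroup ρ x)} := by
  have heq : {x : X | ¬ HasNormalSylow p (inertiaSubgroup ρ x)} =
      ⋃ H ∈ {H : Subgroup G | ¬ HasNormalSylow p H}, ⋂ h ∈ H, {x : X | h ∈ inertiaSubgroup ρ x} := by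
    ext x
    simp only [Set.mem_setOf_eq, Set.mem_iUnion, Set.mem_iInter, exists_prop]
    constructor
    · intro hx
      exact ⟨inertiaSubgroup ρ x, hx, fun h hh => hh⟩
    · rintro ⟨H, hH, hle⟩ hx
      apply hH
      exact (hx.subgroup (H.subgroupOf (inertiaSubgroup ρ x))).of_surjective
        (Subgroup.subgroupOfEquivOfLe hle).toMonoidHom (Subgroup.subgroupOfEquivOfLe hle).surjective
  rw [heq]
  exact (Set.toFinite _).isClosed_biUnion fun H _ => isClosed_biInter fun h _ => hcl h

/-- **Finiteness of the non-p-closed locus over the centre of a point move (regular threefold).**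
In the setting of ✓`isClosed_and_surjective_of_not_hasNormalSylow_inertia` — equivariant blow-up
`π : X♯ → X′` of the finite stable set `Z` of closed points, lifted action `ρs`, `X′ → X₁` affine
and invariant, Jacobson Noetherian `X♯` — with `𝒪_{X′,z}` regular of dimension `3` and residue
characteristics `p` at every point over `Z`: the set of points over `Z` whose inertia group is not
p-closed is FINITE (and consists of closed `κ(z)`-rational points). [folklore] -/
theorem finite_npc_over_centre (p : ℕ) [Fact p.Prime]
    {X' X₁ : Scheme.{0}} (q : X' ⟶ X₁) [IsAffineHom q]
    {G : Type} [Group G] [Finite G] (ρ : G →* Aut X') (hfaith : Function.Injective ρ)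
    (hρ : ∀ g : G, (ρ g).hom ≫ q = q) [IsIntegral X'] [IsLocallyNoetherian X']
    [JacobsonSpace X']
    {Z : Set X'} (hZc : IsClosed Z) (hZf : Z.Finite) (hZpt : ∀ z ∈ Z, IsClosed ({z} : Set X'))
    {Xs : Scheme.{0}} {π : Xs ⟶ X'}
    (hπ : IsBlowup π (Scheme.IdealSheafData.vanishingIdeal ⟨Z, hZc⟩)) [IsIntegral Xs]
    [JacobsonSpace Xs] [NoetherianSpace Xs]
    (ρs : G →* Aut Xs) (hequiv : ∀ g : G, (ρs g).hom ≫ π = π ≫ (ρ g).hom)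
    (hcharZ : ∀ x : Xs, π.base x ∈ Z → CharP (ResidueField (X'.presheaf.stalk (π.base x))) p)
    (hcharX : ∀ x : Xs, π.base x ∈ Z → CharP (ResidueField (Xs.presheaf.stalk x)) p)
    (hregZ : ∀ x : Xs, π.base x ∈ Z → IsRegularLocalRing (X'.presheaf.stalk (π.base x)))
    (hdimZ : ∀ x : Xs, π.base x ∈ Z → ringKrullDim (X'.presheaf.stalk (π.base x)) = (3 : ℕ)) :
    ({x : Xs | π.base x ∈ Z ∧ ¬ HasNormalSylow p (inertiaSubgroup ρs x)}).Finite := by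
  haveI : IsProper π := hπ.isProper
  -- the action on `X♯` is over the separated `π ≫ q`
  have hρs : ∀ g : G, (ρs g).hom ≫ (π ≫ q) = π ≫ q := fun g => by
    rw [← Category.assoc, hequiv g, Category.assoc, hρ g]
  have hcl : ∀ h : G, IsClosed {x : Xs | h ∈ inertiaSubgroup ρs x} :=
    fun h => isClosed_inertiaLocus_of_isSeparated (π ≫ q) ρs hρs h
  have hnpc : IsClosed {x : Xs | ¬ HasNormalSylow p (inertiaSubgroup ρs x)} :=
    isClosed_npc' ρs p hcl
  have hclosed : IsClosed {x : Xs | π.base x ∈ Z ∧ ¬ HasNormalSylow p (inertiaSubgroup ρs x)} :=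
    (hZc.preimage π.continuous).inter hnpc
  refine CampaignW46.SurfaceGrowth.finite_of_isClosed_of_forall_isClosed_singleton hclosed
    fun x hx => ?_
  obtain ⟨hxZ, hxnpc⟩ := hx
  haveI := hcharZ x hxZ
  haveI := hcharX x hxZ
  haveI := hregZ x hxZ
  exact (isClosed_and_surjective_of_not_hasNormalSylow_inertia p q ρ hfaith hρ hZc hZf hZpt hπ ρs
    hequiv x hxZ (hdimZ x hxZ) hxnpc).1

end Summit.ResolutionOfSingularities.ResolutionOfSingularities.Theorems.WildQuotientResolution.PointMoveNoNpcCurves
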